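/-
Origin: expansion seat `prover-pub-hodgecm-mc-discharge-3-g7-0`, handover #7 16:58Z md5 e22a8b9a09b2 (150 l.; NEW additive KERNEL leaf, ns HodgeCM.Model.HypCensus; imports `HodgeCM.Model.HypCensus.ArchDatumBlockCM`; 4 data defs (`negIdxEquivUnit`, `posIdxEquivFin` generic via `Fintype.equivOfCardEq`/`equivFinOfCardEq`; `cmNegIdxEquivUnit`, `cmPosIdxEquivFin` at the pin), 0 Prop defs, 9 thms: `negIdx_val_eq`, `card_negIdx_eq_one`, `card_posIdx_eq` (= N − 1), `cmSignConv_cmPlace_eq_one`, `cmXV_cmPlace_apply` (= re ι₁(dV i), weil-2 `placeSignVec_cmRealVec`), `cmXV_cmPlace_neg/_pos`, `h₁V_of_signature`, **`isArchWeilDatum_cmBlock_of_signature`** (N = 3: `hW` of BRICK-4 § 2 with eP := cmPosIdxEquivFin (Fin (3−1) = Fin 2), eQ := cmNegIdxEquivUnit; inputs h21 : ∃ i₀, re ι₁(dV i₀) < 0 ∧ ∀ i ≠ i₀, 0 < re ι₁(dV i), h₁W, hV, hW). 0 records, nothing cited, MODEL-N ±0, E unchanged. EVIDENCE: hub-farm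 `lean check` rc 0 / 0 sorries / 0 warnings, 93 s, ≈16:58Z, concatenation `mc/pub-hodgecm-mc-discharge-3/notes/check_block7_concat.lean` 92b48783bd52 (3699 l. = check_block_concat + row #7); `#print axioms isArchWeilDatum_cmBlock_of_signature` = trio.) (`HOME/mc/pub-hodgecm-mc-discharge-3/stage/HodgeCM/Model/HypCensus/ArchDatumBlockFramesCM.lean`, md5 e22a8b9a, 153 lines);
landed by the gen-12 packager (p-g12) in gate run 36 as `HodgeCM/Model/HypCensus/ArchDatumBlockFramesCM.lean` (verbatim).
-/
/-
Origin: speedrun cell pub-hodgecm, MODEL-CONSTRUCTION sub-cell, discharge seat mc-discharge-3 (unit pub-hodgecm-mc-discharge-3,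
seat prover-pub-hodgecm-mc-discharge-3-g7-0, gen 7), ticket D-3 follow-on row #7: the two frame bijections of row #6 CONSTRUCTED from the
signature-(2,1) sign fact at `ι₁` (unitary-1's `frameD_sign_ι₁` shape).  Target in PKG: `HodgeCM/Model/HypCensus/ArchDatumBlockFramesCM.lean`
(NEW additive leaf; imports row #6).  KERNEL only: 0 records / named facts / proof holes.
-/
import Summits.HodgeConjecture.HodgeCM.Model.HypCensus.ArchDatumBlockCM

/-!
# Census kit (rows A12/A34), junction (J-arch)→(J-plc): the block-frame bijections from the `(2,1)` sign fact

Row #6 (`ArchDatumBlockCM`) leaves two inputs `eP : PosIdx (cmXV … v₁) ≃ Fin 2`, `eQ : NegIdx (cmXV … v₁) ≃ Unit` — the identification of the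
canonical `V`-frame at the place under `ι₁` with the literal index types of the ball frame `UForm (Fin 2) Unit`.  Here they are CONSTRUCTED
from the sign fact «through `ι₁` exactly one `d_V i₀` is negative and the others are positive» (the shape of unitary-1's
`WmInstanceV2.frameD_sign_ι₁`, read off `HermSpace3.signature_ι₁` by Sylvester's law):

* §1 generic: for a real vector `x` with `x i₀ < 0` and `x i > 0` (`i ≠ i₀`), `NegIdx x = {i₀}` (`card_negIdx_eq_one`), `card (PosIdx x) = N − 1`
  (`card_posIdx_eq`), and the bijections `negIdxEquivUnit`, `posIdxEquivFin`;
* §2 the pin: at `v₁ = cmPlace ι₁` the canonical sign convention is `+1` (`cmSignConv_cmPlace_eq_one`) and the sign vector is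
  `i ↦ re ι₁(d_V i)` (`cmXV_cmPlace_apply`), whence **`cmNegIdxEquivUnit`**, **`cmPosIdxEquivFin`**, and for `N = 3` the big datum of row #6
  with NO frame input: **`isArchWeilDatum_cmBlock_of_signature`** (the matching `s`, `hs_cont`, `hs` are row #6's at these bijections).

Nothing here is a claim of PerL/QW8.  Style lint (L-notation): no `local notation`.
-/

set_option autoImplicit false

noncomputable section

open NumberField NumberField.InfinitePlace IsDedekindDomain MeasureTheory
open scoped Matrix
open scoped Kronecker Classical TensorProduct ComplexConjugate
open Literature.NumberTheory.Automorphic Literature.NumberTheory.Automorphic.UnitaryGroup Literature.NumberTheory.Weil1964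
open Literature.RepresentationTheory.HeisenbergGroup (polar Heisenberg symplecticGroup ofSymplectic)
open Literature.RepresentationTheory.KonnoKonno2007 Literature.RepresentationTheory.KonnoKonno2007.RealDualPair
open Literature.NumberTheory.GelbartRogawski1991 Literature.NumberTheory.GelbartRogawski1991.UnitaryDualPair
open Literature.Analysis.SegalBargmann

namespace HodgeCM.Model.HypCensus

/-! ## §1 Sign frames of a vector with exactly one negative entry -/

section SignFrameCard

variable {N : ℕ} {x : Fin N → ℝ}

/-- with `x i₀ < 0` and `x i > 0` for `i ≠ i₀`, every non-positive index is `i₀`. -/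
theorem negIdx_val_eq (i₀ : Fin N) (h : ∀ i, i ≠ i₀ → 0 < x i) (j : NegIdx x) : j.1 = i₀ := by
  by_contra hne
  exact j.2 (h j.1 hne)

/-- … so `NegIdx x` has exactly one element. -/
theorem card_negIdx_eq_one (i₀ : Fin N) (hi₀ : x i₀ < 0) (h : ∀ i, i ≠ i₀ → 0 < x i) : Fintype.card (NegIdx x) = 1 :=
  Fintype.card_eq_one_iff.2 ⟨⟨i₀, not_lt.2 hi₀.le⟩, fun j => Subtype.ext (negIdx_val_eq i₀ h j)⟩

/-- … and `PosIdx x` has `N − 1` elements. -/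
theorem card_posIdx_eq (i₀ : Fin N) (hi₀ : x i₀ < 0) (h : ∀ i, i ≠ i₀ → 0 < x i) : Fintype.card (PosIdx x) = N - 1 := by
  have hc : Fintype.card (NegIdx x) = Fintype.card (Fin N) - Fintype.card (PosIdx x) :=
    Fintype.card_subtype_compl fun i => 0 < x i
  rw [card_negIdx_eq_one i₀ hi₀ h, Fintype.card_fin] at hc
  have hle : Fintype.card (PosIdx x) ≤ N := (Fintype.card_subtype_le _).trans_eq (Fintype.card_fin N)
  omega

/-- **`NegIdx x ≃ Unit`** for a vector with exactly one negative entry. -/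
def negIdxEquivUnit (i₀ : Fin N) (hi₀ : x i₀ < 0) (h : ∀ i, i ≠ i₀ → 0 < x i) : NegIdx x ≃ Unit :=
  Fintype.equivOfCardEq (by rw [card_negIdx_eq_one i₀ hi₀ h, Fintype.card_unit])

/-- **`PosIdx x ≃ Fin (N − 1)`** for a vector with exactly one negative entry. -/
def posIdxEquivFin (i₀ : Fin N) (hi₀ : x i₀ < 0) (h : ∀ i, i ≠ i₀ → 0 < x i) : PosIdx x ≃ Fin (N - 1) :=
  Fintype.equivFinOfCardEq (card_posIdx_eq i₀ hi₀ h)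

end SignFrameCard

/-! ## §2 The pin: the canonical `V`-frame at the place under `ι₁` -/

section CMPinFrames

variable (L : Type) [Field L] [NumberField L] [IsCMField L] {N : ℕ}
variable (dV : Fin N → L) (hdV : ∀ i, IsCMField.complexConj L (dV i) = dV i) (ι₁ : L →+* ℂ)

/-- under «all but one of the `re ι₁(d_V i)` are positive» the canonical sign convention at the place under `ι₁` is `+1`. -/
theorem cmSignConv_cmPlace_eq_one (h : ∃ i₀ : Fin N, ∀ i, i ≠ i₀ → 0 < (ι₁ (dV i)).re) :
    cmSignConv L dV ι₁ (cmPlace L ι₁) = 1 := by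
  have hc : (cmPlace L ι₁).1 = (InfinitePlace.mk ι₁).comap (algebraMap (↥(maximalRealSubfield L)) L) := rfl
  rw [cmSignConv, if_pos hc, if_pos h]

/-- hence the canonical `V`-sign vector at that place is `i ↦ re ι₁(d_V i)`. -/
theorem cmXV_cmPlace_apply (h : ∃ i₀ : Fin N, ∀ i, i ≠ i₀ → 0 < (ι₁ (dV i)).re) (i : Fin N) :
    cmXV L dV hdV ι₁ (cmPlace L ι₁) i = (ι₁ (dV i)).re := by
  show placeSignVec (cmRealVec L dV hdV) (cmSignConv L dV ι₁) (cmPlace L ι₁) i = _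
  rw [placeSignVec_cmRealVec L (cmPlace L ι₁) ι₁ rfl dV hdV (cmSignConv L dV ι₁) i, cmSignConv_cmPlace_eq_one L dV ι₁ h, div_one]

variable {L dV hdV ι₁}

/-- the negative index in the canonical frame. -/
theorem cmXV_cmPlace_neg {i₀ : Fin N} (h21 : (ι₁ (dV i₀)).re < 0 ∧ ∀ i, i ≠ i₀ → 0 < (ι₁ (dV i)).re) :
    cmXV L dV hdV ι₁ (cmPlace L ι₁) i₀ < 0 := by
  rw [cmXV_cmPlace_apply L dV hdV ι₁ ⟨i₀, h21.2⟩]; exact h21.1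

/-- the positive indices in the canonical frame. -/
theorem cmXV_cmPlace_pos {i₀ : Fin N} (h21 : (ι₁ (dV i₀)).re < 0 ∧ ∀ i, i ≠ i₀ → 0 < (ι₁ (dV i)).re) :
    ∀ i, i ≠ i₀ → 0 < cmXV L dV hdV ι₁ (cmPlace L ι₁) i := fun i hi => by
  rw [cmXV_cmPlace_apply L dV hdV ι₁ ⟨i₀, h21.2⟩]; exact h21.2 i hi

variable (L dV hdV ι₁)

/-- **`eQ`**: the negative block of the canonical `V`-frame at the place under `ι₁` is a point. -/
def cmNegIdxEquivUnit (h21 : ∃ i₀ : Fin N, (ι₁ (dV i₀)).re < 0 ∧ ∀ i, i ≠ i₀ → 0 < (ι₁ (dV i)).re) :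
    NegIdx (cmXV L dV hdV ι₁ (cmPlace L ι₁)) ≃ Unit :=
  negIdxEquivUnit h21.choose (cmXV_cmPlace_neg h21.choose_spec) (cmXV_cmPlace_pos h21.choose_spec)

/-- **`eP`**: the positive block of the canonical `V`-frame at the place under `ι₁` has `N − 1` elements. -/
def cmPosIdxEquivFin (h21 : ∃ i₀ : Fin N, (ι₁ (dV i₀)).re < 0 ∧ ∀ i, i ≠ i₀ → 0 < (ι₁ (dV i)).re) :
    PosIdx (cmXV L dV hdV ι₁ (cmPlace L ι₁)) ≃ Fin (N - 1) :=
  posIdxEquivFin h21.choose (cmXV_cmPlace_neg h21.choose_spec) (cmXV_cmPlace_pos h21.choose_spec)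

omit [NumberField L] [IsCMField L] in
/-- the `(2,1)`-type sign fact implies the weaker «all but one have a common strict sign» hypothesis `h₁V` of the consumer's form. -/
theorem h₁V_of_signature (h21 : ∃ i₀ : Fin N, (ι₁ (dV i₀)).re < 0 ∧ ∀ i, i ≠ i₀ → 0 < (ι₁ (dV i)).re) :
    ∃ i₀ : Fin N, (∀ i, i ≠ i₀ → 0 < (ι₁ (dV i)).re) ∨ ∀ i, i ≠ i₀ → (ι₁ (dV i)).re < 0 :=
  ⟨h21.choose, Or.inl h21.choose_spec.2⟩

end CMPinFrames

/-! ## §3 `N = 3`: the big datum of row #6 with no frame input -/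

section CMPinThree

variable (L : Type) [Field L] [NumberField L] [IsCMField L] {M n : ℕ} (e : Fin 3 × Fin M ≃ Fin n)
variable (dV : Fin 3 → L) (hdV : ∀ i, IsCMField.complexConj L (dV i) = dV i) (hdV0 : ∀ i, dV i ≠ 0)
variable (dW : Fin M → L) (hdW : ∀ i, IsCMField.complexConj L (dW i) = dW i) (hdW0 : ∀ i, dW i ≠ 0)
variable (hGR : (cmSplittingDatum L e dV hdV hdV0 dW hdW hdW0).CompatibleSplitting) (ι₁ : L →+* ℂ)

/-- **`hW` of BRICK-4 § 2 at the pin, `V` of rank 3 and signature `(2,1)` at `ι₁`, from sign facts only**: the frames `eP`, `eQ` are the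
canonical `cmPosIdxEquivFin` (`Fin (3 − 1) = Fin 2`) and `cmNegIdxEquivUnit`. Inputs: `h21` (`frameD_sign_ι₁`), `h₁W`, `hV`
(`frameD_sign_of_ne`), `hW` (automatic for `M = 2`, cf. `isArchWeilDatum_cmBlock_two`). -/
theorem isArchWeilDatum_cmBlock_of_signature
    (h21 : ∃ i₀ : Fin 3, (ι₁ (dV i₀)).re < 0 ∧ ∀ i, i ≠ i₀ → 0 < (ι₁ (dV i)).re)
    (h₁W : (∀ j, 0 < (ι₁ (dW j)).re) ∨ ∀ j, (ι₁ (dW j)).re < 0)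
    (hV : ∀ τ : L →+* ℂ, InfinitePlace.mk τ ≠ InfinitePlace.mk ι₁ →
      (∀ i, 0 < (τ (dV i)).re) ∨ ∀ i, (τ (dV i)).re < 0)
    (hW : ∀ τ : L →+* ℂ, InfinitePlace.mk τ ≠ InfinitePlace.mk ι₁ →
      (∃ j₀ : Fin M, ∀ j, j ≠ j₀ → 0 < (τ (dW j)).re) ∨ ∀ j, (τ (dW j)).re < 0) :
    IsArchWeilDatum
      (cmBlockPhaseHom L e dV hdV hdV0 dW hdW hdW0 ι₁ (cmPosIdxEquivFin L dV hdV ι₁ h21) (cmNegIdxEquivUnit L dV hdV ι₁ h21))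
      (cmBlockRep L e dV hdV hdV0 dW hdW hdW0 hGR ι₁ (cmPosIdxEquivFin L dV hdV ι₁ h21) (cmNegIdxEquivUnit L dV hdV ι₁ h21)) :=
  isArchWeilDatum_cmBlock L e dV hdV hdV0 dW hdW hdW0 hGR ι₁ _ _ (h₁V_of_signature L dV ι₁ h21) h₁W hV hW

end CMPinThree

end HodgeCM.Model.HypCensus

end
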